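import Summits.QuantumFields.BalabanUV.Beta.FP.FineHessianNearLedgerCore
import Summits.QuantumFields.BalabanUV.Beta.FP.PerfectPolarizationWard

/-!
# `BalabanUV.Beta.FP.FineHessianNearLedger` — road «FP» for binder row D1, ROW KER-γ (α2) sub-row α2-b PART 3b = THE (LEDGER) SKELETON, THE COMPOSED END (owner memo
# `KER-GAMMA-ALPHA2.md` §3∕§5, R-FP-34∕35∕36): THE NEAR PIECE OF THE JUNCTION AS A NAMED FINITE LEDGER — with the slice exchange `hslice` (H′1-KER), the
# MIX split (α2-a PART 2) and the ghost split (α2-c) DISPLAYED, the near difference `(F m − N⁸·PiBF(s′−s))·𝟙[‖s′−s‖∞ ≤ N]` IS the sum of the SEVEN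
# GLUON-CORE WORDS of PART 2 (bounded, proved here) + the displayed MIX pieces + the displayed ghost pieces + the normalisation piece; hence
# (ASYMP) at the bi-vertex perfect kernel ⟸ H2V-4 letters ∧ colour ∧ far letter ∧ `hslice` ∧ the two displayed splits ∧ ONE (rem) LEDGER LINE PER NAMED PIECE

HONEST DEPENDENCY (page 1, mandatory): continuum YM on T⁴ ⇐ BetaPertH ∧ nine spine estimates (0/9 proved); BetaPertH ⇐ (D1) ∧ (D4) ∧ CAP+tail;
G-an2-4 gates asym, D1 and NE2/3/4.  HONEST FRAMING (cell contract, verbatim): «discharging `BetaPertH` makes Bałaban's UV stability UNCONDITIONAL —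
a real constructive-QFT result; it is NOT the continuum limit and NOT the Clay problem.»  THIS MODULE DISCHARGES NOTHING of the wall: it is [folklore]
bookkeeping (finite sums of two-point tables under a window indicator; entry bounds of the seven words from `ContactCount.abs_tadpole∕bubble_le_of_entryBound`
and the two-leg twin proved here) and a BY-NAME composition of PART 2 `FineHessianGluonCore.fineHessA_gluonCore`∕`fineHessA_Pker_eq_ff`, PART 0
`FineHessianTransportTable.PiBF_eq_fineHessA`, leaf-01-g11's (E) `FineSplitJunctionLedger.hasym_PiBF_vertex2OfK_of_far_nearPieces` and
`PerfectPolarizationWard.bdd_Pker`.  EVERY analytic input is a DISPLAYED HYPOTHESIS: `hslice` (the slice exchange at table level, H′1-KER — shared lane,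
an2 W-4; NOT proved anywhere yet for the literal), `hmix` (α2-a PART 2), `hgh` (α2-c), the unit constants `(c m, a m)` with `c m²·a m² = (Lc^m)⁸·wg` (N0b-S),
the letters of the slice leg's remainder `R m` and of the slice stencils, and ONE (rem) ledger number per named piece.  No `def`, no `def … : Prop`, nothing
cited, 0 sorry; 0∕4 row-D1 binders; NOT hsplit (its `hslice`∕`hmix`∕`hgh` members are hypotheses), NOT any ledger line, NOT (ASYMP) for the literal, NOT D1,
NOT BetaPertH, NOT continuum, NOT Clay.  «not in print; our bookkeeping».  (The unit constants `(c m, a m, b m)` and the bubble weight `κ m` with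
`(Lc^m)⁸·wg = c m·b m = κ m·(c m)²·(a m)²` are N0b-S∕W data in the sense of an3's located answer Q2 — NOT chosen here.)

ABSOLUTE RULE (cell charter, verbatim): «No internally-minted statement may enter as a cited fact. Every hypothesis is either kernel-proved in this package or a
verbatim quotation of a PUBLISHED theorem with page reference. The manuscript(s) under audit are NOT citable for their own disputed steps — they are the thing
under adjudication; programme-internal (2001/route/tribunal) claims are never citable.»

WHAT (§1–§3 = the sibling core module `FineHessianNearLedgerCore`: `abs_biBubble_le_of_entryBound`, `gluonCore_weighted`, `near_gluonCore_eq_seven`,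
`bounded_seven`, `nearSplit_of_slice` — split for the 400-line rule).  §4 [our object] **`hasym_PiBF_vertex2OfK_of_sliceLedger`** — (E)'s END with
`hnearSplit`∕`hGb` DISCHARGED by §2–§3 at the road's objects (`P := blk Pker tt` bounded by `bdd_Pker`, the comparison identity by PART 0 + PART 2 §1): what
remains, BY TYPE, is {H2V-4 letters, colour equation, jet letters, far letter, `hslice`, `hmix`, `hgh`, units + bubble weight, slice-leg∕stencil letters,
boundedness of the displayed pieces, the (rem) ledger lines}.
Provenance: road FP OWNER b2b-balaban-beta-d1-p3 gen 10 (prover-b2b-balaban-beta-d1-p3-g10-0), 2026-08-21, sub-row α2-b part 3b ∕ (LEDGER) skeleton, composed END.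
-/

noncomputable section

namespace Summit.QuantumFields.BalabanUV.Beta.FP.FineHessianNearLedger

open Finset
open scoped BigOperators
open Literature.MathematicalPhysics.QuantumFieldTheory.Balaban1983to89
open Literature.MathematicalPhysics.QuantumFieldTheory.Balaban1983to89.Beta
open Literature.MathematicalPhysics.QuantumFieldTheory.Balaban1983to89.Beta.BubbleTransfer (c4)
open Literature.MathematicalPhysics.QuantumFieldTheory.Balaban1983to89.B12Normalization (stepBal)
open B12Sec2to5 (l1 l1_nonneg)
open PolarizationSign (reflSign)
open ExpKernelCalculus (Site MKer BiLoc comp shiftK tr tadpole bubble Zl Zl_nonneg)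
open KernelWard (Bdd divV divW)
open KernelReflection (LegMap refK bondRefl tadpole_smul bubble_smul_left bubble_smul_right)
open StepJetData (biLoc_smul)
open OneStepResolventKernel (Fib LocStencil)
open OneStepKernelFamily (colH)
open DyadicShell (Pt supNorm)
open LeadingCoefficient (kappaBal)
open AxialProjector (coProj)
open AxialDressing (axDressK)
open SecondOrderResponse (vertex2OfK)
open Summit.QuantumFields.BalabanUV.Beta.GAN24.CombesThomas (sfStep smStep)
open Summit.QuantumFields.BalabanUV.Beta.D1BFx.MomentTransferPeriodicEntry (EKer₂ dressedEntryP)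
open Summit.QuantumFields.BalabanUV.Beta.D1BFx.ReducedKernelSandwichLeg (fineHessA fineHessA_apply)
open Summit.QuantumFields.BalabanUV.Beta.D1BFx.DressedTablesLeg (tadpoleTableA_apply bubbleTableA_apply)
open Summit.QuantumFields.BalabanUV.Beta.D1BFx.PackedKernelSplit (inj blk biLoc_blk)
open Summit.QuantumFields.BalabanUV.Beta.D1BFx.ContactCount (abs_comp_le_of_entryBound abs_comp_le_of_rightLoc abs_tr_le_of_rightLoc
  abs_tadpole_le_of_entryBound abs_bubble_le_of_entryBound)
open Summit.QuantumFields.BalabanUV.Beta.FP.PerfectObjectsT (KPerf TPerfOf)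
open Summit.QuantumFields.BalabanUV.Beta.FP.WilsonCubicGerm (cubicGermOf)
open Summit.QuantumFields.BalabanUV.Beta.FP.GhostCubicGerm (cubicGermOfSc)
open Summit.QuantumFields.BalabanUV.Beta.FP.BubbleGermValue (bfGerm ghostGerm)
open Summit.QuantumFields.BalabanUV.Beta.FP.PerfectPolarization (Pker G0ker PiBF)
open Summit.QuantumFields.BalabanUV.Beta.FP.PerfectPolarizationWard (bdd_Pker)
open Summit.QuantumFields.BalabanUV.Beta.FP.FineHessianGluonCore (fineHessA_gluonCore fineHessA_Pker_eq_ff bdd_smul)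
open Summit.QuantumFields.BalabanUV.Beta.FP.FineHessianTransportTable (PiBF_eq_fineHessA)
open Summit.QuantumFields.BalabanUV.Beta.FP.FineSplitJunctionLedger (hasym_PiBF_vertex2OfK_of_far_nearPieces)

open Summit.QuantumFields.BalabanUV.Beta.FP.FineHessianNearLedgerCore (abs_ite_le bdd_blk nearSplit_of_slice bounded_seven)

/-! ## §4 The composed END: (ASYMP) at the bi-vertex perfect kernel from the slice ledger -/

section End

variable {Lc : ℕ} [NeZero Lc]

/-- **(ASYMP) FOR THE PERFECT ONE-LOOP KERNEL WITH THE BI-VERTEX SLOT ⟸ H2V-4 LETTERS ∧ COLOUR ∧ JET LETTERS ∧ FAR LETTER ∧ `hslice` ∧ MIX SPLIT ∧ GHOST SPLIT ∧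
ONE (rem) LEDGER LINE PER NAMED PIECE** [our object].  This is leaf-01-g11's (E) `FineSplitJunctionLedger.hasym_PiBF_vertex2OfK_of_far_nearPieces` with its
`hnearSplit` and `hGb` DISCHARGED by §2–§3 at the road's objects: comparison leg `P := blk Pker tt` (bounded: `PerfectPolarizationWard.bdd_Pker`), comparison
data = the ff blocks of `PiBF`'s `(V, W)`, comparison identity by PART 0 `PiBF_eq_fineHessA` + PART 2 `fineHessA_Pker_eq_ff`, factor `r := (Lc^m)⁸`.
DISPLAYED per `m ≥ 1` (nothing of it proved here): the units `(c m, a m, b m)` and the bubble weight `κ m` with the TWO unit relations `(Lc^m)⁸·wg = c m·b m`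
(tadpole) and `(Lc^m)⁸·wg = κ m·(c m)²·(a m)²` (bubble) (N0b-S∕W and an3's (D-κ) convention — the road does not choose them), the slice leg's remainder `R m`
(bounded) and the slice stencils∕bi-tables `Ssl m`, `Wsl m` (bi-localised at the H2V rate `δ`), the slice exchange `hslice` (H′1-KER with α2-a PART 1 folded in;
gluon word in the weighted form `½·tadpole Γ Wsl − ½·κ·bubble Γ Ssl Ssl`), the MIX split `hmix` (α2-a PART 2) and ghost split `hgh` (α2-c) into BOUNDED pieces,
and the ledger numbers `B7 : Fin 7 → ℝ`, `Bmix`, `Bgh`, `BN`.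
Conclusion: `∃ U ≥ 0, ∃ Cg, ∀ m ≥ 1, |secondMoment (T m) μ ν − m·stepBal N Lc| ≤ (U + (Σ_i B7 i + (Σ_{JM} Bmix + (Σ_{JG} Bgh + BN)))) + Cg`.
(`κ m = 1`, `b m = c m·(a m)²` is the plain `fineHessA` form of PART 2's `fineHessA_gluonCore`.) -/
theorem hasym_PiBF_vertex2OfK_of_sliceLedger (hLc : 2 ≤ Lc) (wg wgh : ℝ)
    {V : Fin 4 → Site 4 → MKer 4 (Fib 3)} {W : Fin 4 → Site 4 → Fin 4 → Site 4 → MKer 4 (Fib 3)}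
    {v : Fin 4 → Site 4 → MKer 4 Unit} {w : Fin 4 → Site 4 → Fin 4 → Site 4 → MKer 4 Unit} {Cv Cw Cx Cw' Cx' CwL CwL' cQ δ : ℝ} (hδ : 0 < δ)
    -- admissible-family letters, gluon sector
    (hV : ∀ (μ : Fin 4) (y : Site 4), BiLoc (V μ y) y y Cv δ) (hW : ∀ (μ : Fin 4) (y : Site 4) (ν : Fin 4) (y' : Site 4), BiLoc (W μ y ν y') y y' Cw δ)
    (hcovV : ∀ (μ : Fin 4) (y t : Site 4), V μ (y + t) = shiftK (-t) (V μ y))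
    (hcovW : ∀ (μ : Fin 4) (y : Site 4) (ν : Fin 4) (y' t : Site 4), W μ (y + t) ν (y' + t) = shiftK (-t) (W μ y ν y'))
    (X : Site 4 → MKer 4 (Fib 3)) (hX : ∀ y, BiLoc (X y) y y Cx δ)
    (hW1 : ∀ y, comp (comp Pker (divV V y)) Pker = comp Pker (X y) - comp (X y) Pker)
    (hW2 : ∀ y ν y', divW W y ν y' = comp (X y) (V ν y') - comp (V ν y') (X y))
    (hreflP : ∀ α : Fin 4, ∃ Φα : LegMap 4 (Fib 3), refK Φα Pker = Pker ∧ ∃ c : ℤ,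
      (∀ μ y, V μ (bondRefl α c μ y) = reflSign α μ • refK Φα (V μ y)) ∧
      (∀ μ y ν y', W μ (bondRefl α c μ y) ν (bondRefl α c ν y') = (reflSign α μ * reflSign α ν) • refK Φα (W μ y ν y')))
    (h0V : ∀ (lam α β : Fin 4), ∑' p : Pt × Pt, V lam 0 p.1 p.2 (Sum.inl α) (Sum.inl β) = 0)
    (hgermV : cubicGermOf V = cQ • bfGerm)
    (hWloc : ∀ (μ ν : Fin 4) (z : Pt), BiLoc (W μ 0 ν z) 0 z (CwL * Real.exp (-δ * l1 z)) δ)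
    -- admissible-family letters, ghost sector
    (hv : ∀ (μ : Fin 4) (y : Site 4), BiLoc (v μ y) y y Cv δ) (hw : ∀ (μ : Fin 4) (y : Site 4) (ν : Fin 4) (y' : Site 4), BiLoc (w μ y ν y') y y' Cw' δ)
    (hcovv : ∀ (μ : Fin 4) (y t : Site 4), v μ (y + t) = shiftK (-t) (v μ y))
    (hcovw : ∀ (μ : Fin 4) (y : Site 4) (ν : Fin 4) (y' t : Site 4), w μ (y + t) ν (y' + t) = shiftK (-t) (w μ y ν y'))
    (Xg : Site 4 → MKer 4 Unit) (hXg : ∀ y, BiLoc (Xg y) y y Cx' δ)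
    (hW1g : ∀ y, comp (comp G0ker (divV v y)) G0ker = comp G0ker (Xg y) - comp (Xg y) G0ker)
    (hW2g : ∀ y ν y', divW w y ν y' = comp (Xg y) (v ν y') - comp (v ν y') (Xg y))
    (hreflG : ∀ α : Fin 4, ∃ Ψα : LegMap 4 Unit, refK Ψα G0ker = G0ker ∧ ∃ c : ℤ,
      (∀ μ y, v μ (bondRefl α c μ y) = reflSign α μ • refK Ψα (v μ y)) ∧
      (∀ μ y ν y', w μ (bondRefl α c μ y) ν (bondRefl α c ν y') = (reflSign α μ * reflSign α ν) • refK Ψα (w μ y ν y')))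
    (h0v : ∀ lam : Fin 4, ∑' p : Pt × Pt, v lam 0 p.1 p.2 () () = 0)
    (hgermv : cubicGermOfSc v = ghostGerm)
    (hwloc : ∀ (μ ν : Fin 4) (z : Pt), BiLoc (w μ 0 ν z) 0 z (CwL' * Real.exp (-δ * l1 z)) δ)
    -- the colour weights and the entry
    {N : ℝ} (hn : (40 * wg * (1 / 4 : ℝ) * (c4 * cQ) ^ 2 - wgh * (-(1 / 2 : ℝ)) * c4 ^ 2) / 3 = kappaBal N)
    {μ ν : Fin 4} (hμν : μ ≠ ν)
    -- the road's first-order stencils and bi-tables at every `m` (letters per `m`, constants free)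
    {S : ℕ → Fin (3 + 1) → (Fin (3 + 1) → ℤ) → MKer (3 + 1) (Fib 3)}
    (hS : ∀ m : ℕ, 1 ≤ m → ∃ Cs δs : ℝ, 0 < δs ∧ LocStencil (S m) Cs δs ∧
      ∀ κ u t, S m κ (u + ((Lc ^ m : ℕ) : ℤ) • t) = shiftK (-(((Lc ^ m : ℕ) : ℤ) • t)) (S m κ u))
    {Wf : ℕ → Fin (3 + 1) → (Fin (3 + 1) → ℤ) → Fin (3 + 1) → (Fin (3 + 1) → ℤ) → MKer (3 + 1) (Fib 3)}
    (hWf : ∀ m : ℕ, 1 ≤ m → ∃ C2 δ2 : ℝ, 0 < δ2 ∧ (∀ κ' u l' u', BiLoc (Wf m κ' u l' u') u u' C2 δ2) ∧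
      ∀ κ' u l' u' t, Wf m κ' (u + ((Lc ^ m : ℕ) : ℤ) • t) l' (u' + ((Lc ^ m : ℕ) : ℤ) • t)
        = shiftK (-(((Lc ^ m : ℕ) : ℤ) • t)) (Wf m κ' u l' u'))
    -- the FAR LETTER of the full fine kernel (m-free shape)
    {CF af : ℝ} (hCF : 0 ≤ CF) (haf : 0 < af)
    (hfar : ∀ m : ℕ, 1 ≤ m → ∀ (c e : Fin 4) (s s' : Pt), Lc ^ m < supNorm (s' - s) →
      |fineHessA (axDressK (Lc ^ m) (KPerf (d := 3) Lc (sfStep Lc) (smStep 3 Lc) m)) (coProj (Lc ^ m) (S m)) (Wf m) c e s s'|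
        ≤ ((Lc ^ m : ℕ) : ℝ) ^ 8 * (CF / (supNorm (s' - s) : ℝ) ^ 6 * Real.exp (-(af / ((Lc ^ m : ℕ) : ℝ)) * (supNorm (s' - s) : ℝ))))
    -- THE DISPLAYED SLICE DATA per `m`: units and bubble weight, remainder leg, slice stencils∕bi-tables, and the slice exchange `hslice`
    {c a b κ : ℕ → ℝ} (hunits₁ : ∀ m : ℕ, 1 ≤ m → (((Lc ^ m : ℕ) : ℝ) ^ 8) * wg = c m * b m)
    (hunits₂ : ∀ m : ℕ, 1 ≤ m → (((Lc ^ m : ℕ) : ℝ) ^ 8) * wg = κ m * (c m ^ 2 * a m ^ 2))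
    {R : ℕ → MKer 4 (Fin 4)} (hRb : ∀ m : ℕ, 1 ≤ m → ∃ CR, Bdd (R m) CR)
    {Ssl : ℕ → Fin 4 → Site 4 → MKer 4 (Fin 4)} (hSsl : ∀ m : ℕ, 1 ≤ m → ∃ Cs, ∀ κ u, BiLoc (Ssl m κ u) u u Cs δ)
    {Wsl : ℕ → Fin 4 → Site 4 → Fin 4 → Site 4 → MKer 4 (Fin 4)} (hWsl : ∀ m : ℕ, 1 ≤ m → ∃ C2, ∀ κ u l u', BiLoc (Wsl m κ u l u') u u' C2 δ)
    {Fmix Fgh FN : ℕ → EKer₂ 4}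
    (hslice : ∀ m : ℕ, 1 ≤ m → ∀ (c' e : Fin 4) (s s' : Pt),
      fineHessA (axDressK (Lc ^ m) (KPerf (d := 3) Lc (sfStep Lc) (smStep 3 Lc) m)) (coProj (Lc ^ m) (S m)) (Wf m) c' e s s'
        = ((1 / 2 : ℝ) * tadpole (c m • blk Pker true true + R m) (Wsl m c' s e s')
            - (1 / 2 : ℝ) * κ m * bubble (c m • blk Pker true true + R m) (Ssl m c' s) (Ssl m e s'))
          + Fmix m c' e s s' + Fgh m c' e s s' + FN m c' e s s')
    -- THE DISPLAYED MIX SPLIT (α2-a PART 2) and GHOST SPLIT (α2-c) into bounded pieces, and the normalisation piece's bound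
    {ιM : Type*} (JM : Finset ιM) {Gmix : ιM → ℕ → EKer₂ 4}
    (hmix : ∀ m : ℕ, 1 ≤ m → ∀ (c' e : Fin 4) (s s' : Pt),
      (if supNorm (s' - s) ≤ Lc ^ m then Fmix m c' e s s' else 0) = ∑ k ∈ JM, Gmix k m c' e s s')
    (hGmix : ∀ k ∈ JM, ∀ m : ℕ, 1 ≤ m → ∀ c' e : Fin 4, ∃ A, ∀ s s', |Gmix k m c' e s s'| ≤ A)
    {ιG : Type*} (JG : Finset ιG) {Ggh : ιG → ℕ → EKer₂ 4}
    (hgh : ∀ m : ℕ, 1 ≤ m → ∀ (c' e : Fin 4) (s s' : Pt),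
      (if supNorm (s' - s) ≤ Lc ^ m then Fgh m c' e s s' + ((Lc ^ m : ℕ) : ℝ) ^ 8 * wgh * fineHessA G0ker v w c' e s s' else 0)
        = ∑ k ∈ JG, Ggh k m c' e s s')
    (hGgh : ∀ k ∈ JG, ∀ m : ℕ, 1 ≤ m → ∀ c' e : Fin 4, ∃ A, ∀ s s', |Ggh k m c' e s s'| ≤ A)
    (hFN : ∀ m : ℕ, 1 ≤ m → ∀ c' e : Fin 4, ∃ A, ∀ s s', |FN m c' e s s'| ≤ A)
    -- THE (rem) LEDGER: one number per named piece
    {B7 : Fin 7 → ℝ} {Bmix : ιM → ℝ} {Bgh : ιG → ℝ} {BN : ℝ}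
    (hL0 : ∀ m : ℕ, 1 ≤ m → ∀ S' : Finset Pt, ∑ u ∈ S', (supNorm u : ℝ) ^ 2 *
      |dressedEntryP (fun c'' a' => colH (KPerf (d := 3) Lc (sfStep Lc) (smStep 3 Lc) m) (Lc ^ m) a' 0 c'')
        (fun c' e s s' => if supNorm (s' - s) ≤ Lc ^ m then (1 / 2 : ℝ) * tadpole (R m) (Wsl m c' s e s') else 0)
        (((Lc ^ m : ℕ) : ℤ) • (-u)) μ ν| ≤ B7 0)
    (hL1 : ∀ m : ℕ, 1 ≤ m → ∀ S' : Finset Pt, ∑ u ∈ S', (supNorm u : ℝ) ^ 2 *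
      |dressedEntryP (fun c'' a' => colH (KPerf (d := 3) Lc (sfStep Lc) (smStep 3 Lc) m) (Lc ^ m) a' 0 c'')
        (fun c' e s s' => if supNorm (s' - s) ≤ Lc ^ m then
          -((1 / 2 : ℝ) * κ m) * tr (comp (comp (c m • blk Pker true true) (Ssl m c' s)) (comp (R m) (Ssl m e s'))) else 0)
        (((Lc ^ m : ℕ) : ℤ) • (-u)) μ ν| ≤ B7 1)
    (hL2 : ∀ m : ℕ, 1 ≤ m → ∀ S' : Finset Pt, ∑ u ∈ S', (supNorm u : ℝ) ^ 2 *
      |dressedEntryP (fun c'' a' => colH (KPerf (d := 3) Lc (sfStep Lc) (smStep 3 Lc) m) (Lc ^ m) a' 0 c'')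
        (fun c' e s s' => if supNorm (s' - s) ≤ Lc ^ m then
          -((1 / 2 : ℝ) * κ m) * tr (comp (comp (R m) (Ssl m c' s)) (comp (c m • blk Pker true true) (Ssl m e s'))) else 0)
        (((Lc ^ m : ℕ) : ℤ) • (-u)) μ ν| ≤ B7 2)
    (hL3 : ∀ m : ℕ, 1 ≤ m → ∀ S' : Finset Pt, ∑ u ∈ S', (supNorm u : ℝ) ^ 2 *
      |dressedEntryP (fun c'' a' => colH (KPerf (d := 3) Lc (sfStep Lc) (smStep 3 Lc) m) (Lc ^ m) a' 0 c'')
        (fun c' e s s' => if supNorm (s' - s) ≤ Lc ^ m then -((1 / 2 : ℝ) * κ m) * bubble (R m) (Ssl m c' s) (Ssl m e s') else 0)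
        (((Lc ^ m : ℕ) : ℤ) • (-u)) μ ν| ≤ B7 3)
    (hL4 : ∀ m : ℕ, 1 ≤ m → ∀ S' : Finset Pt, ∑ u ∈ S', (supNorm u : ℝ) ^ 2 *
      |dressedEntryP (fun c'' a' => colH (KPerf (d := 3) Lc (sfStep Lc) (smStep 3 Lc) m) (Lc ^ m) a' 0 c'')
        (fun c' e s s' => if supNorm (s' - s) ≤ Lc ^ m then
          (1 / 2 : ℝ) * tadpole (c m • blk Pker true true) (Wsl m c' s e s' - b m • blk (W c' s e s') true true) else 0)
        (((Lc ^ m : ℕ) : ℤ) • (-u)) μ ν| ≤ B7 4)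
    (hL5 : ∀ m : ℕ, 1 ≤ m → ∀ S' : Finset Pt, ∑ u ∈ S', (supNorm u : ℝ) ^ 2 *
      |dressedEntryP (fun c'' a' => colH (KPerf (d := 3) Lc (sfStep Lc) (smStep 3 Lc) m) (Lc ^ m) a' 0 c'')
        (fun c' e s s' => if supNorm (s' - s) ≤ Lc ^ m then
          -((1 / 2 : ℝ) * κ m) * bubble (c m • blk Pker true true) (Ssl m c' s - a m • blk (V c' s) true true) (Ssl m e s') else 0)
        (((Lc ^ m : ℕ) : ℤ) • (-u)) μ ν| ≤ B7 5)
    (hL6 : ∀ m : ℕ, 1 ≤ m → ∀ S' : Finset Pt, ∑ u ∈ S', (supNorm u : ℝ) ^ 2 *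
      |dressedEntryP (fun c'' a' => colH (KPerf (d := 3) Lc (sfStep Lc) (smStep 3 Lc) m) (Lc ^ m) a' 0 c'')
        (fun c' e s s' => if supNorm (s' - s) ≤ Lc ^ m then
          -((1 / 2 : ℝ) * κ m) * bubble (c m • blk Pker true true) (a m • blk (V c' s) true true) (Ssl m e s' - a m • blk (V e s') true true) else 0)
        (((Lc ^ m : ℕ) : ℤ) • (-u)) μ ν| ≤ B7 6)
    (hLmix : ∀ k ∈ JM, ∀ m : ℕ, 1 ≤ m → ∀ S' : Finset Pt, ∑ u ∈ S', (supNorm u : ℝ) ^ 2 *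
      |dressedEntryP (fun c'' a' => colH (KPerf (d := 3) Lc (sfStep Lc) (smStep 3 Lc) m) (Lc ^ m) a' 0 c'') (Gmix k m)
        (((Lc ^ m : ℕ) : ℤ) • (-u)) μ ν| ≤ Bmix k)
    (hLgh : ∀ k ∈ JG, ∀ m : ℕ, 1 ≤ m → ∀ S' : Finset Pt, ∑ u ∈ S', (supNorm u : ℝ) ^ 2 *
      |dressedEntryP (fun c'' a' => colH (KPerf (d := 3) Lc (sfStep Lc) (smStep 3 Lc) m) (Lc ^ m) a' 0 c'') (Ggh k m)
        (((Lc ^ m : ℕ) : ℤ) • (-u)) μ ν| ≤ Bgh k)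
    (hLN : ∀ m : ℕ, 1 ≤ m → ∀ S' : Finset Pt, ∑ u ∈ S', (supNorm u : ℝ) ^ 2 *
      |dressedEntryP (fun c'' a' => colH (KPerf (d := 3) Lc (sfStep Lc) (smStep 3 Lc) m) (Lc ^ m) a' 0 c'')
        (fun c' e s s' => if supNorm (s' - s) ≤ Lc ^ m then FN m c' e s s' else 0)
        (((Lc ^ m : ℕ) : ℤ) • (-u)) μ ν| ≤ BN) :
    ∃ U : ℝ, 0 ≤ U ∧ ∃ Cg : ℝ, ∀ m : ℕ, 1 ≤ m →
      |B12Beta.secondMoment (TPerfOf (Lc ^ m) (KPerf (d := 3) Lc (sfStep Lc) (smStep 3 Lc) m) (S m)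
          (vertex2OfK (KPerf (d := 3) Lc (sfStep Lc) (smStep 3 Lc) m) (Lc ^ m) (Wf m))) μ ν - (m : ℝ) * stepBal N Lc|
        ≤ (U + (∑ i : Fin 7, B7 i + (∑ k ∈ JM, Bmix k + (∑ k ∈ JG, Bgh k + BN)))) + Cg := by
  classical
  -- the comparison leg and data on the ff fibre
  have hPb : Bdd (blk Pker true true) PerfectPropagatorLegData.A0P := bdd_blk bdd_Pker true true
  have hVtt : ∀ κ y, BiLoc (blk (V κ y) true true) y y Cv δ := fun κ y => biLoc_blk (hV κ y) true true
  have hWtt : ∀ κ y l y', BiLoc (blk (W κ y l y') true true) y y' Cw δ := fun κ y l y' => biLoc_blk (hW κ y l y') true true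
  -- the comparison identity at the road's objects (PART 0 + PART 2 §1)
  have hPi : ∀ (c' e : Fin 4) (s s' : Pt), PiBF wg wgh V W v w c' e (s' - s)
      = wg * fineHessA (blk Pker true true) (fun κ y => blk (V κ y) true true) (fun κ y l y' => blk (W κ y l y') true true) c' e s s'
        - wgh * fineHessA G0ker v w c' e s s' := fun c' e s s' => by
    rw [PiBF_eq_fineHessA wg wgh hcovV hcovW hcovv hcovw, fineHessA_Pker_eq_ff]
  -- the named piece family and its ledger
  let G : (Fin 7 ⊕ (ιM ⊕ (ιG ⊕ Unit))) → ℕ → EKer₂ 4 := fun j m =>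
    Sum.elim
      (![(fun c' e s s' => if supNorm (s' - s) ≤ Lc ^ m then (1 / 2 : ℝ) * tadpole (R m) (Wsl m c' s e s') else 0 : EKer₂ 4),
         (fun c' e s s' => if supNorm (s' - s) ≤ Lc ^ m then
            -((1 / 2 : ℝ) * κ m) * tr (comp (comp (c m • blk Pker true true) (Ssl m c' s)) (comp (R m) (Ssl m e s'))) else 0),
         (fun c' e s s' => if supNorm (s' - s) ≤ Lc ^ m then
            -((1 / 2 : ℝ) * κ m) * tr (comp (comp (R m) (Ssl m c' s)) (comp (c m • blk Pker true true) (Ssl m e s'))) else 0),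
         (fun c' e s s' => if supNorm (s' - s) ≤ Lc ^ m then -((1 / 2 : ℝ) * κ m) * bubble (R m) (Ssl m c' s) (Ssl m e s') else 0),
         (fun c' e s s' => if supNorm (s' - s) ≤ Lc ^ m then
            (1 / 2 : ℝ) * tadpole (c m • blk Pker true true) (Wsl m c' s e s' - b m • blk (W c' s e s') true true) else 0),
         (fun c' e s s' => if supNorm (s' - s) ≤ Lc ^ m then
            -((1 / 2 : ℝ) * κ m) * bubble (c m • blk Pker true true) (Ssl m c' s - a m • blk (V c' s) true true) (Ssl m e s') else 0),
         (fun c' e s s' => if supNorm (s' - s) ≤ Lc ^ m then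
            -((1 / 2 : ℝ) * κ m) * bubble (c m • blk Pker true true) (a m • blk (V c' s) true true) (Ssl m e s' - a m • blk (V e s') true true) else 0)])
      (Sum.elim (fun k => Gmix k m) (Sum.elim (fun k => Ggh k m)
        (fun _ c' e s s' => if supNorm (s' - s) ≤ Lc ^ m then FN m c' e s s' else 0))) j
  let B : (Fin 7 ⊕ (ιM ⊕ (ιG ⊕ Unit))) → ℝ := Sum.elim B7 (Sum.elim Bmix (Sum.elim Bgh fun _ => BN))
  let J : Finset (Fin 7 ⊕ (ιM ⊕ (ιG ⊕ Unit))) := (Finset.univ : Finset (Fin 7)).disjSum (JM.disjSum (JG.disjSum ({()} : Finset Unit)))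
  have hsumB : ∑ j ∈ J, B j = ∑ i : Fin 7, B7 i + (∑ k ∈ JM, Bmix k + (∑ k ∈ JG, Bgh k + BN)) := by
    simp only [J, B, Finset.sum_disjSum, Sum.elim_inl, Sum.elim_inr, Finset.sum_singleton]
  -- the near split
  have hnearSplit : ∀ m : ℕ, 1 ≤ m → ∀ (c' e : Fin 4) (s s' : Pt),
      (if supNorm (s' - s) ≤ Lc ^ m then
          fineHessA (axDressK (Lc ^ m) (KPerf (d := 3) Lc (sfStep Lc) (smStep 3 Lc) m)) (coProj (Lc ^ m) (S m)) (Wf m) c' e s s'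
            - ((Lc ^ m : ℕ) : ℝ) ^ 8 * PiBF wg wgh V W v w c' e (s' - s) else 0) = ∑ j ∈ J, G j m c' e s s' := by
    intro m hm c' e s s'
    obtain ⟨CR, hR⟩ := hRb m hm
    obtain ⟨Cs, hSs⟩ := hSsl m hm
    obtain ⟨C2, hW2⟩ := hWsl m hm
    rw [nearSplit_of_slice hPb hR (c m) (a m) (b m) (κ m) (((Lc ^ m : ℕ) : ℝ) ^ 8) wg wgh (hunits₁ m hm) (hunits₂ m hm) (Lc ^ m) hSs hVtt hW2 hWtt hδ
      (Ftab := fun c' e s s' => fineHessA (axDressK (Lc ^ m) (KPerf (d := 3) Lc (sfStep Lc) (smStep 3 Lc) m)) (coProj (Lc ^ m) (S m)) (Wf m) c' e s s')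
      (hslice m hm) hPi JM (hmix m hm) JG (Ggh := fun k => Ggh k m) (by
        intro c' e s s'
        have h := hgh m hm c' e s s'
        simpa [mul_assoc] using h) c' e s s']
  -- boundedness of the named pieces
  have hGb : ∀ j ∈ J, ∀ m : ℕ, 1 ≤ m → ∀ c' e : Fin 4, ∃ A, ∀ s s', |G j m c' e s s'| ≤ A := by
    rintro (j | k | k | ⟨⟩) hj m hm c' e
    · obtain ⟨CR, hR⟩ := hRb m hm
      obtain ⟨Cs, hSs⟩ := hSsl m hm
      obtain ⟨C2, hW2⟩ := hWsl m hm
      obtain ⟨A, h0, h1, h2, h3, h4, h5, h6⟩ :=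
        bounded_seven hPb hR (c m) (a m) (b m) (κ m) (Lc ^ m) hSs hVtt hW2 hWtt hδ c' e
      refine ⟨A, fun s s' => ?_⟩
      fin_cases j
      · exact h0 s s'
      · exact h1 s s'
      · exact h2 s s'
      · exact h3 s s'
      · exact h4 s s'
      · exact h5 s s'
      · exact h6 s s'
    · have hk : k ∈ JM := by simpa [J, Finset.mem_disjSum] using hj
      exact hGmix k hk m hm c' e
    · have hk : k ∈ JG := by simpa [J, Finset.mem_disjSum] using hj
      exact hGgh k hk m hm c' e
    · obtain ⟨A, hA⟩ := hFN m hm c' e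
      exact ⟨A, fun s s' => (abs_ite_le _ _).trans (hA s s')⟩
  -- the ledger of the named pieces
  have hledger : ∀ j ∈ J, ∀ m : ℕ, 1 ≤ m → ∀ S' : Finset Pt, ∑ u ∈ S', (supNorm u : ℝ) ^ 2 *
      |dressedEntryP (fun c'' a' => colH (KPerf (d := 3) Lc (sfStep Lc) (smStep 3 Lc) m) (Lc ^ m) a' 0 c'') (G j m)
        (((Lc ^ m : ℕ) : ℤ) • (-u)) μ ν| ≤ B j := by
    rintro (j | k | k | ⟨⟩) hj m hm S'
    · fin_cases j
      · exact hL0 m hm S'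
      · exact hL1 m hm S'
      · exact hL2 m hm S'
      · exact hL3 m hm S'
      · exact hL4 m hm S'
      · exact hL5 m hm S'
      · exact hL6 m hm S'
    · have hk : k ∈ JM := by simpa [J, Finset.mem_disjSum] using hj
      exact hLmix k hk m hm S'
    · have hk : k ∈ JG := by simpa [J, Finset.mem_disjSum] using hj
      exact hLgh k hk m hm S'
    · exact hLN m hm S'
  obtain ⟨U, hU, Cg, hEnd⟩ := hasym_PiBF_vertex2OfK_of_far_nearPieces hLc wg wgh hδ hV hW hcovV hcovW X hX hW1 hW2 hreflP h0V hgermV hWloc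
    hv hw hcovv hcovw Xg hXg hW1g hW2g hreflG h0v hgermv hwloc hn hμν hS hWf hCF haf hfar J hnearSplit hGb hledger
  refine ⟨U, hU, Cg, fun m hm => ?_⟩
  rw [← hsumB]
  exact hEnd m hm

end End

end Summit.QuantumFields.BalabanUV.Beta.FP.FineHessianNearLedger

end
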